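import Mathlib
import Summits.Ventures.PercRepro.TriangleCapTriangleFreeTable

/-!
# PercRepro — THE TRIANGLE-FREE CHERRY TABLE, THE MAXIMUM ATTAINED (p3, gen 42; part 182)

Part 181 bounds `Σ_v d(v)² + r (k − 1 − r) ≤ m k` on every triangle-free graph and names the extremal ones.
Here the bound is shown to be a MAXIMUM on every cell: `K_{a,k−a}` minus `r` edges at one vertex
(`bipMinusStar k a r`, part 140) is triangle-free (`cliqueFree_bipMinusStar`) and attains it
(`sum_deg_sq_bipMinusStar`), the edgeless graph serving the cell `m = 0`.  `cliqueFree_cherry_table_attained`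
restates part 181's table with the attained maximum, in the degree form.  Axioms: standard.
-/

namespace PercRepro

namespace TriangleCap

namespace C047

open Finset

/-- `K_{a,n−a}` minus a star is triangle-free (a spanning subgraph of a complete bipartite graph). -/
theorem cliqueFree_bipMinusStar (n a r : ℕ) : (bipMinusStar n a r).CliqueFree 3 :=
  (cliqueFree_bip n a).anti (bipMinusStar_le_bip n a r)

/-- **THE CLOSED FORM IS ATTAINED:** `K_{a,n−a}` minus `r` edges at one vertex has
`Σ_v d(v)² + r (n − 1 − r) = m n` with `m = a(n−a) − r`. -/
theorem sum_deg_sq_bipMinusStar (n a r : ℕ) (ha : 1 ≤ a) (har : a + r ≤ n) (hn : 2 ≤ n) :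
    ∑ v, deg (bipMinusStar n a r) v * deg (bipMinusStar n a r) v +
        r * (Fintype.card (Fin n) - 1 - r) =
      (bipMinusStar n a r).edgeFinset.card * Fintype.card (Fin n) := by
  have h1 := two_mul_cherries_bipMinusStar n a r ha har hn
  have h2 := two_mul_cherries_add (bipMinusStar n a r)
  have h3 := sum_deg_eq (bipMinusStar n a r)
  have h4 := card_edges_bipMinusStar n a r ha har
  rw [Fintype.card_fin]
  obtain ⟨c, rfl⟩ : ∃ c, n = a + c := ⟨n - a, by omega⟩
  rw [Nat.add_sub_cancel_left] at h1 h4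
  obtain ⟨n', hn'⟩ : ∃ n', a + c = n' + 2 := ⟨a + c - 2, by omega⟩
  rw [hn'] at h1 h2 h3 h4 ⊢
  have e1 : n' + 2 - 1 - r = n' + 1 - r := by omega
  have e2 : 2 * (n' + 2) - r - 3 = 2 * n' + 1 - r := by omega
  have e3 : n' + 2 - 2 = n' := by omega
  rw [e1]
  rw [e2, e3] at h1
  have hr : r ≤ n' + 1 := by omega
  obtain ⟨Y, hY⟩ : ∃ Y, n' + 1 - r = Y := ⟨_, rfl⟩
  have hX : 2 * n' + 1 - r = Y + n' := by omega
  rw [hY]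
  rw [hX] at h1
  nlinarith [h1, h2, h3, h4]

/-- **THE TRIANGLE-FREE CHERRY TABLE WITH ITS MAXIMUM ATTAINED:** for every `k ≥ 1` and `m ≤ k²/4`, with
`a(k−a) = m + r` the least product above `m`, every triangle-free graph on `Fin k` with `m` edges has
`Σ_v d(v)² + r (k − 1 − r) ≤ m k`, and some triangle-free graph with `m` edges attains it. -/
theorem cliqueFree_cherry_table_attained (k m : ℕ) (hk : 1 ≤ k) (hm : 4 * m ≤ k * k) :
    ∃ a r : ℕ, 2 * a + r ≤ k ∧ a * (k - a) = m + r ∧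
      (∀ a' : ℕ, a' ≤ k → m ≤ a' * (k - a') → a * (k - a) ≤ a' * (k - a')) ∧
      (∀ (D : SimpleGraph (Fin k)) [DecidableRel D.Adj], D.CliqueFree 3 → D.edgeFinset.card = m →
        ∑ v, deg D v * deg D v + r * (k - 1 - r) ≤ m * k) ∧
      ∃ (D : SimpleGraph (Fin k)) (_ : DecidableRel D.Adj), D.CliqueFree 3 ∧ D.edgeFinset.card = m ∧
        ∑ v, deg D v * deg D v + r * (k - 1 - r) = m * k := by
  obtain ⟨a, r, hak, hprod, hleast, hall⟩ := cliqueFree_cherry_table k m hk hm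
  refine ⟨a, r, hak, hprod, hleast, fun D _ hfree hD => (hall D hfree hD).1, ?_⟩
  rcases Nat.eq_zero_or_pos a with ha0 | ha1
  · -- the cell `m = 0`: the edgeless graph
    subst ha0
    have hm0 : m = 0 := by simp at hprod; omega
    have hr0 : r = 0 := by simp at hprod; omega
    subst hm0 hr0
    refine ⟨⊥, inferInstance, SimpleGraph.cliqueFree_bot (by norm_num), ?_, ?_⟩
    · simp
    · have : ∀ v : Fin k, deg (⊥ : SimpleGraph (Fin k)) v = 0 := fun v => by
        unfold deg
        simp
      simp [this]
  · refine ⟨bipMinusStar k a r, inferInstance, cliqueFree_bipMinusStar k a r, ?_, ?_⟩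
    · have := card_edges_bipMinusStar k a r ha1 (by omega)
      omega
    · have := sum_deg_sq_bipMinusStar k a r ha1 (by omega) (by omega)
      rw [Fintype.card_fin] at this
      have hE := card_edges_bipMinusStar k a r ha1 (by omega)
      have hEm : (bipMinusStar k a r).edgeFinset.card = m := by omega
      rw [hEm] at this
      exact this

end C047

end TriangleCap

end PercRepro
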